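import Summits.QuantumFields.BalabanUV.T4Continuum.Support.VariationalColourTaxiTowerProjGRate
import Summits.QuantumFields.BalabanUV.T4Continuum.Support.VariationalColourTaxiTowerColourLeaves

/-!
# T⁴ programme, spine node NE2 (U1a), lane P2 — «V-AVG-G AT TAXI DATA», file 10: THE VECTOR END WITH RATE AT BAŁABAN's TAXI DATA FOR THE COVARIANT PROJECTED
# GAUGE FUNCTIONAL FROM OPERATOR DATA — the colour scalar pair's five leaves at the taxi frames DISCHARGED by `colour_leaves_taxi` under the class
# (file 9 ∘ leaf-04-g7's file 7; model level; cell `pub-balaban`)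

NE2 formalisation swarm `b2b-balaban-t4-ne2-formalise-*`, leaf prover 10 GEN 6 (`prover-b2b-balaban-t4-ne2-formalise-leaf-10-g6-0`, V-END holder lineage); item
«V-AVG-G AT TAXI DATA», file 10 (journal NOTE l.22515, NEXT l.23033, ONLINE l.24052).  Composition BY NAME of file 9
`VariationalColourTaxiTowerProjGRate.towerLimitRate_effV_taxiTower_projG_of_class` (g5's junction, filed by this seat as p243605) — the RATE END at taxi data for Bałaban's `projG` with
NO (ONE-min) leaf, displaying the colour scalar pair's five leaves at the taxi frames with UNIFORM constants `Λc, CPc, CRc` — with leaf-04-g7's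
`VariationalColourTaxiTowerColourLeaves.colour_leaves_taxi` (p238840: those five leaves FROM DATA at every level `k`, with LEVEL constants
`Λ_k = Λc_k + (ε₁,k·CR_k + 2δ′_k·√((1+ε₁,k·CR_k)·136) + δ′_k²·136)(Λc_k + 1)`, `Λc_k = 2d·36^d((1 + L^k(d−1)(L^k−1)a_k)² + 9)`, `CR_k = 2Λc_k + 2d(a_k(L^k)²) +
d²(a_k(L^k)²)²·136`, `C_P = 136`) and the class package `VariationalColourTaxiTowerEndMin.taxiClassPackage` (the level plaquette bounds `a_k` with `(L^k)²a_k ≤ c`).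
Nothing defined.

THE STATEMENTS.
 * §1 `leaf_consts_le`: under `(L^k)²a ≤ c`, `(L^{k+1})²b_k ≤ c` (`1 ≤ L`) the level constants are majorised by the k-FREE
   `Λcu = 2d·36^d((1 + (d−1)c)² + 9)`, `CRu = 2Λcu + 2dc + d²c²·136`, `ε₁u = (d∕4 + ½)L`, `δ′u = √(2d(1+d²))·(2(d−1)Lc)`, `Λu = Λcu + (ε₁u·CRu + 2δ′u·√((1+ε₁u·CRu)·136) +
   δ′u²·136)(Λcu + 1)` (real arithmetic: `L^k(L^k−1)a ≤ c`, `a(L^k)² ≤ c`, `L∕(L^k)² ≤ L`, `L^k·L·(L−1)(2L−1)·b_k ≤ 2Lc`, monotonicity).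
 * §2 **`colour_leaves_taxi_uniform`**: for a coherent unitary one-step tower in the plaquette class with `hsm1`–`hsm3`, `hsm6` (`2 ≤ L`, `1 ≤ d`, `1 < M_μ`), the five
   colour leaves at the taxi frames hold AT EVERY LEVEL with the uniform constants `Λu`, `136`, `CRu` — exactly file 9's displayed binders `hUBc hUBf hPcc hPf hREGc`.
 * §3 **`towerLimitRate_effV_taxiTower_projG_of_data`** = file 9 with those five binders and `{Λc CPc CRc}` GONE (`Λc := Λu`, `CPc := 136`, `CRc := CRu` in the
   rate constants `EH1`, `E21`): the vector END WITH RATE for `effV (L^k) M (Rlev k) (GmProj … ker Q_{taxi,k}) (QmL (nestLv k)) aa` at rate `θ` (`0 < θ < 1`, `L⁻¹ ≤ θ²`)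
   from: the one-step bond data (unitary, plaquette class `(L^{k+1})²b_k ≤ c`, coherent), the DISPLAYED regular presentation `(ar_k, ℓr_k)` of `Rlev k` with its classes
   `L^k·ar_k ≤ α`, `(L^k)²·ℓr_k ≤ λ`, and NUMERIC smallness only (`hsm1`–`hsm7`, `hsmV`, `hsmG`, `hsmallδ`, `hsmallQ` — polynomial in `c`, resp. in `(d, α, λ, c)` through
   `Cst d 1` and `36^d`).  NO (SLICE-min) ∕ (ONE-min) ∕ (G″) ∕ (GF3) ∕ V-REG ∕ colour-leaf hypothesis remains: every analytic socket of the lineage's rate END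
   (leaf-10-g3 `towerLimitRate_effV_of_leaves` → g4 `…_avgG` → g5 F1–F4) is inhabited at Bałaban's taxi data by theorems of the tree.
NOT HERE: a gauge fixing producing the regular presentation (leaf-04-g8 «WILSON-LINE TOWERS» inhabits it by the lattice approximants of Lipschitz continuum
connections); the EXISTENCE twin with no displayed decay line (next file, over leaf-04-g7's `effV_tendsto_taxiTower_projG_centred_regular` p241220).

HONEST FRAMING (T4-DAG p. 1).  Kernel composition at the MODEL level (finite torus, fibre `ℂ`, our discrete forms, taxi ∕ straight contours OURS; [B9] (3.10)∕(3.15)∕(3.19),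
[B5] (1.69)–(1.70) SHAPES only; no B0, c5); [folklore] real arithmetic; nothing printed is a hypothesis.  The smallness thresholds are n-UNIFORM and genuine but
QUANTITATIVELY VOID (memo GF3COV §3: at `d = 2`, `α ≲ 7·10⁻¹³`, `λ ≲ 4·10⁻⁹`, `c ≲ 3·10⁻⁸`); the rate `θ` carries the half exponent (`θ² ≥ L⁻¹`); the located caveat of
part 8 (memo VGF (V2′): in the fixed-class model the measured one-step costs do not decay geometrically — the RATE shape is the conditional shape of an asymptotically
free trajectory) is untouched by this file, which only removes displayed sockets.  V-END with background in Bałaban's (1.1)–(1.3) renormalisation flow ∕ NE2 NOT proved;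
NE3 OPEN; spine PROVED 0∕9 unchanged; rung (B)+1 on a fixed finite T⁴ — NOT infinite volume, NOT mass gap, NOT Clay.  No `def`, no `def … : Prop`, no `sorry`; axioms
standard.  HONEST DEPENDENCY (cell, verbatim): continuum YM on T⁴ ⇐ BetaPertH ∧ nine spine estimates (0/9 proved); BetaPertH ⇐ (D1) ∧ (D4) ∧ CAP+tail; G-an2-4 gates
asym, D1 and NE2/3/4.
-/

noncomputable section

namespace Summit.QuantumFields.BalabanUV.T4Continuum.VariationalColourTaxiTowerProjGRateData

open Finset
open scoped Matrix ComplexOrder BigOperators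
open Literature.MathematicalPhysics.QuantumFieldTheory.Balaban1983to89.B5Prop11Plancherel (Tor fine unitVec Cst)
open Literature.MathematicalPhysics.QuantumFieldTheory.Balaban1983to89.B5Composition116 (sites)
open Summit.QuantumFields.BalabanUV.T4Continuum.VariationalColourFederbush (norm_le_one_of_mem_unitary)
open Summit.QuantumFields.BalabanUV.T4Continuum.VariationalColourTower (Rtrv)
open Summit.QuantumFields.BalabanUV.T4Continuum.VariationalColourTaxiTransport
open Summit.QuantumFields.BalabanUV.T4Continuum.CovariantAveragingTower (TowerLimitRate)
open Summit.QuantumFields.BalabanUV.T4Continuum.VectorBlockTrialForm (nsqV QvL kappaV)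
open Summit.QuantumFields.BalabanUV.T4Continuum.VariationalVectorForm (ScV lamV)
open Summit.QuantumFields.BalabanUV.T4Continuum.VariationalVectorEffective (effV)
open Summit.QuantumFields.BalabanUV.T4Continuum.VariationalVectorTower (QmL)
open Summit.QuantumFields.BalabanUV.T4Continuum.VariationalVectorEndOfLeaves (eV ePV)
open Summit.QuantumFields.BalabanUV.T4Continuum.VariationalVectorGaugeSlice (avgOp projG)
open Summit.QuantumFields.BalabanUV.T4Continuum.VariationalVectorRegularityCovariant (GmProj)
open Summit.QuantumFields.BalabanUV.T4Continuum.SliceComplementFlatGap (deltaGap)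
open Summit.QuantumFields.BalabanUV.T4Continuum.VariationalColourTaxiTowerProjGRate (towerLimitRate_effV_taxiTower_projG_of_class)
open Summit.QuantumFields.BalabanUV.T4Continuum.VariationalColourScalarPair (Scv Sfv qWv qVv Qkv Q1v Scv_nonneg)
open Summit.QuantumFields.BalabanUV.T4Continuum.VariationalColourUpperBound (nsqv nsqv_nonneg)
open Summit.QuantumFields.BalabanUV.T4Continuum.VariationalColourOneStepPhys (rhov)

variable {d : ℕ}

/-! ## §1 The level constants of `colour_leaves_taxi` under the class -/

/-- `L^k·((d−1)(L^k−1)a) ≤ (d−1)c` and `a(L^k)² ≤ c` from `(L^k)²a ≤ c`. [folklore] -/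
theorem level_atoms_le (L : ℕ) {a c : ℝ} {k : ℕ} (ha0 : 0 ≤ a) (hac : (((L ^ k : ℕ)) : ℝ) ^ 2 * a ≤ c) :
    ((L ^ k : ℕ) : ℝ) * (((d - 1 : ℕ) : ℝ) * ((L ^ k - 1 : ℕ) : ℝ) * a) ≤ ((d - 1 : ℕ) : ℝ) * c ∧ a * (((L ^ k : ℕ) : ℝ)) ^ 2 ≤ c := by
  have hD0 : (0 : ℝ) ≤ ((d - 1 : ℕ) : ℝ) := Nat.cast_nonneg _
  have hn1r : ((L ^ k - 1 : ℕ) : ℝ) ≤ ((L ^ k : ℕ) : ℝ) := by exact_mod_cast Nat.sub_le (L ^ k) 1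
  refine ⟨?_, by rw [mul_comm]; exact hac⟩
  calc ((L ^ k : ℕ) : ℝ) * (((d - 1 : ℕ) : ℝ) * ((L ^ k - 1 : ℕ) : ℝ) * a)
      = ((d - 1 : ℕ) : ℝ) * ((((L ^ k : ℕ) : ℝ) * ((L ^ k - 1 : ℕ) : ℝ)) * a) := by ring
    _ ≤ ((d - 1 : ℕ) : ℝ) * ((((L ^ k : ℕ) : ℝ) * ((L ^ k : ℕ) : ℝ)) * a) :=
        mul_le_mul_of_nonneg_left (mul_le_mul_of_nonneg_right (mul_le_mul_of_nonneg_left hn1r (Nat.cast_nonneg _)) ha0) hD0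
    _ = ((d - 1 : ℕ) : ℝ) * ((((L ^ k : ℕ)) : ℝ) ^ 2 * a) := by ring
    _ ≤ ((d - 1 : ℕ) : ℝ) * c := mul_le_mul_of_nonneg_left hac hD0

/-- `(d∕4 + ½)·(L∕(L^k)²) ≤ (d∕4 + ½)·L` (`1 ≤ L`). [folklore] -/
theorem eps1_level_le (L : ℕ) (hL : 1 ≤ L) (k : ℕ) :
    ((d : ℝ) / 4 + 1 / 2) * ((L : ℝ) / (((L ^ k : ℕ) : ℝ)) ^ 2) ≤ ((d : ℝ) / 4 + 1 / 2) * L := by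
  have hL0 : (0 : ℝ) ≤ L := Nat.cast_nonneg L
  have hN1 : (1 : ℝ) ≤ ((L ^ k : ℕ) : ℝ) := by exact_mod_cast Nat.one_le_pow k L hL
  have hN2 : (1 : ℝ) ≤ (((L ^ k : ℕ) : ℝ)) ^ 2 := one_le_pow₀ hN1
  have h : (L : ℝ) / (((L ^ k : ℕ) : ℝ)) ^ 2 ≤ L := div_le_self hL0 hN2
  exact mul_le_mul_of_nonneg_left h (by positivity)

/-- `L^k·L·((d−1)(L−1)(2L−1)b_k) ≤ 2(d−1)Lc` from `(L^{k+1})²b_k ≤ c` (`1 ≤ L`): `(L−1)(2L−1) ≤ 2L²` and `L^k·L² ≤ (L^{k+1})²∕L^k·… ≤ (L^{k+1})²`. [folklore] -/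
theorem deltaP_level_le (L : ℕ) (hL : 1 ≤ L) {b c : ℝ} {k : ℕ} (hb0 : 0 ≤ b) (hbc : (((L ^ (k + 1) : ℕ)) : ℝ) ^ 2 * b ≤ c) :
    ((L ^ k : ℕ) : ℝ) * L * (((d - 1 : ℕ) : ℝ) * ((L - 1 : ℕ) : ℝ) * ((2 * L - 1 : ℕ) : ℝ) * b) ≤ 2 * ((d - 1 : ℕ) : ℝ) * L * c := by
  have hL0 : (0 : ℝ) ≤ L := Nat.cast_nonneg L
  have hD0 : (0 : ℝ) ≤ ((d - 1 : ℕ) : ℝ) := Nat.cast_nonneg _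
  have hN0 : (0 : ℝ) ≤ ((L ^ k : ℕ) : ℝ) := Nat.cast_nonneg _
  have hN1 : (1 : ℝ) ≤ ((L ^ k : ℕ) : ℝ) := by exact_mod_cast Nat.one_le_pow k L hL
  have hL1r : ((L - 1 : ℕ) : ℝ) ≤ L := by exact_mod_cast Nat.sub_le L 1
  have h2L1 : ((2 * L - 1 : ℕ) : ℝ) ≤ 2 * L := by exact_mod_cast Nat.sub_le (2 * L) 1
  have hcast : (((L ^ (k + 1) : ℕ)) : ℝ) = ((L ^ k : ℕ) : ℝ) * L := by push_cast; ring
  have hc0 : (((L ^ k : ℕ) : ℝ) * L) ^ 2 * b ≤ c := by rw [← hcast]; exact hbc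
  have h1 : ((L - 1 : ℕ) : ℝ) * ((2 * L - 1 : ℕ) : ℝ) ≤ (L : ℝ) * (2 * L) := mul_le_mul hL1r h2L1 (Nat.cast_nonneg _) hL0
  have h2 : ((L ^ k : ℕ) : ℝ) * L * (L * b) ≤ c := by
    calc ((L ^ k : ℕ) : ℝ) * L * (L * b) = 1 * (((L ^ k : ℕ) : ℝ) * L * L * b) := by ring
      _ ≤ ((L ^ k : ℕ) : ℝ) * (((L ^ k : ℕ) : ℝ) * L * L * b) := mul_le_mul_of_nonneg_right hN1 (by positivity)
      _ = (((L ^ k : ℕ) : ℝ) * L) ^ 2 * b := by ring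
      _ ≤ c := hc0
  calc ((L ^ k : ℕ) : ℝ) * L * (((d - 1 : ℕ) : ℝ) * ((L - 1 : ℕ) : ℝ) * ((2 * L - 1 : ℕ) : ℝ) * b)
      = ((d - 1 : ℕ) : ℝ) * ((((L - 1 : ℕ) : ℝ) * ((2 * L - 1 : ℕ) : ℝ)) * (((L ^ k : ℕ) : ℝ) * L * b)) := by ring
    _ ≤ ((d - 1 : ℕ) : ℝ) * (((L : ℝ) * (2 * L)) * (((L ^ k : ℕ) : ℝ) * L * b)) :=
        mul_le_mul_of_nonneg_left (mul_le_mul_of_nonneg_right h1 (by positivity)) hD0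
    _ = 2 * ((d - 1 : ℕ) : ℝ) * L * (((L ^ k : ℕ) : ℝ) * L * (L * b)) := by ring
    _ ≤ 2 * ((d - 1 : ℕ) : ℝ) * L * c := mul_le_mul_of_nonneg_left h2 (by positivity)

/-- **THE LEVEL CONSTANTS OF `colour_leaves_taxi` ARE MAJORISED BY THE UNIFORM ONES**: `0 ≤ Λ_k ≤ Λu`, `0 ≤ CR_k ≤ CRu` (letters of `colour_leaves_taxi`, `C_P = 136`). [folklore] -/
theorem leaf_consts_le (L : ℕ) (hL : 1 ≤ L) {a b c : ℝ} {k : ℕ} (ha0 : 0 ≤ a) (hb0 : 0 ≤ b) (hac : (((L ^ k : ℕ)) : ℝ) ^ 2 * a ≤ c)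
    (hbc : (((L ^ (k + 1) : ℕ)) : ℝ) ^ 2 * b ≤ c) :
    let Λc : ℝ := 2 * d * (36 : ℝ) ^ d * ((1 + ((L ^ k : ℕ) : ℝ) * (((d - 1 : ℕ) : ℝ) * ((L ^ k - 1 : ℕ) : ℝ) * a)) ^ 2 + 9)
    let CP : ℝ := 136
    let CR : ℝ := 2 * Λc + 2 * d * (a * (((L ^ k : ℕ) : ℝ)) ^ 2) + (d : ℝ) ^ 2 * (a * (((L ^ k : ℕ) : ℝ)) ^ 2) ^ 2 * CP
    let ε₁ : ℝ := ((d : ℝ) / 4 + 1 / 2) * ((L : ℝ) / (((L ^ k : ℕ) : ℝ)) ^ 2)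
    let δ' : ℝ := Real.sqrt (2 * d * (1 + (d : ℝ) ^ 2)) * ((((L ^ k : ℕ) : ℝ)) * L * (((d - 1 : ℕ) : ℝ) * ((L - 1 : ℕ) : ℝ) * ((2 * L - 1 : ℕ) : ℝ) * b))
    let Λ : ℝ := Λc + (ε₁ * CR + 2 * δ' * Real.sqrt ((1 + ε₁ * CR) * CP) + δ' ^ 2 * CP) * (Λc + 1)
    let Λcu : ℝ := 2 * d * (36 : ℝ) ^ d * ((1 + ((d - 1 : ℕ) : ℝ) * c) ^ 2 + 9)
    let CRu : ℝ := 2 * Λcu + 2 * d * c + (d : ℝ) ^ 2 * c ^ 2 * 136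
    let ε₁u : ℝ := ((d : ℝ) / 4 + 1 / 2) * L
    let δ'u : ℝ := Real.sqrt (2 * d * (1 + (d : ℝ) ^ 2)) * (2 * ((d - 1 : ℕ) : ℝ) * L * c)
    let Λu : ℝ := Λcu + (ε₁u * CRu + 2 * δ'u * Real.sqrt ((1 + ε₁u * CRu) * 136) + δ'u ^ 2 * 136) * (Λcu + 1)
    0 ≤ Λc ∧ Λc ≤ Λcu ∧ 0 ≤ CR ∧ CR ≤ CRu ∧ 0 ≤ ε₁ ∧ ε₁ ≤ ε₁u ∧ 0 ≤ δ' ∧ δ' ≤ δ'u ∧ 0 ≤ Λ ∧ Λ ≤ Λu ∧ 0 ≤ CRu ∧ 0 ≤ Λu := by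
  intro Λc CP CR ε₁ δ' Λ Λcu CRu ε₁u δ'u Λu
  have hd0 : (0 : ℝ) ≤ d := Nat.cast_nonneg d
  have hL0 : (0 : ℝ) ≤ L := Nat.cast_nonneg L
  have hD0 : (0 : ℝ) ≤ ((d - 1 : ℕ) : ℝ) := Nat.cast_nonneg _
  have hN0 : (0 : ℝ) ≤ ((L ^ k : ℕ) : ℝ) := Nat.cast_nonneg _
  obtain ⟨hw, hy⟩ := level_atoms_le (d := d) L ha0 hac
  have hc0 : 0 ≤ c := le_trans (by positivity) hac
  have hw0 : 0 ≤ ((L ^ k : ℕ) : ℝ) * (((d - 1 : ℕ) : ℝ) * ((L ^ k - 1 : ℕ) : ℝ) * a) := by positivity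
  have hy0 : 0 ≤ a * (((L ^ k : ℕ) : ℝ)) ^ 2 := by positivity
  have hΛc0 : 0 ≤ Λc := by positivity
  have hΛc : Λc ≤ Λcu := by
    show 2 * d * (36 : ℝ) ^ d * ((1 + ((L ^ k : ℕ) : ℝ) * (((d - 1 : ℕ) : ℝ) * ((L ^ k - 1 : ℕ) : ℝ) * a)) ^ 2 + 9)
      ≤ 2 * d * (36 : ℝ) ^ d * ((1 + ((d - 1 : ℕ) : ℝ) * c) ^ 2 + 9)
    gcongr
  have hCR0 : 0 ≤ CR := by positivity
  have hCR : CR ≤ CRu := by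
    show 2 * Λc + 2 * d * (a * (((L ^ k : ℕ) : ℝ)) ^ 2) + (d : ℝ) ^ 2 * (a * (((L ^ k : ℕ) : ℝ)) ^ 2) ^ 2 * CP ≤ 2 * Λcu + 2 * d * c + (d : ℝ) ^ 2 * c ^ 2 * 136
    gcongr
  have hε0 : 0 ≤ ε₁ := by positivity
  have hε : ε₁ ≤ ε₁u := eps1_level_le (d := d) L hL k
  have hδ0 : 0 ≤ δ' := by positivity
  have hδ : δ' ≤ δ'u := mul_le_mul_of_nonneg_left (deltaP_level_le (d := d) L hL hb0 hbc) (Real.sqrt_nonneg _)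
  have hΛcu0 : 0 ≤ Λcu := hΛc0.trans hΛc
  have hCRu0 : 0 ≤ CRu := hCR0.trans hCR
  have hε1u0 : 0 ≤ ε₁u := hε0.trans hε
  have hδu0 : 0 ≤ δ'u := hδ0.trans hδ
  have hΛ0 : 0 ≤ Λ := by positivity
  have hΛ : Λ ≤ Λu := by
    show Λc + (ε₁ * CR + 2 * δ' * Real.sqrt ((1 + ε₁ * CR) * CP) + δ' ^ 2 * CP) * (Λc + 1)
      ≤ Λcu + (ε₁u * CRu + 2 * δ'u * Real.sqrt ((1 + ε₁u * CRu) * 136) + δ'u ^ 2 * 136) * (Λcu + 1)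
    gcongr
  have hΛu0 : 0 ≤ Λu := hΛ0.trans hΛ
  exact ⟨hΛc0, hΛc, hCR0, hCR, hε0, hε, hδ0, hδ, hΛ0, hΛ, hCRu0, hΛu0⟩

/-! ## §2 The five colour leaves at the taxi frames with uniform constants -/

section Taxi

variable (L : ℕ) [NeZero L] (M : Fin d → ℕ) [hM : ∀ μ, NeZero (M μ)]
variable {R' : (k : ℕ) → Tor (fine L (fine (L ^ k) M)) → Fin d → (ℂ →L[ℂ] ℂ)}

/-- **THE COLOUR SCALAR PAIR's LEAVES AT BAŁABAN's TAXI FRAMES, EVERY LEVEL, UNIFORM CONSTANTS** — `colour_leaves_taxi` (p238840) at the class package's level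
plaquette bounds, its level constants majorised by §1 (`nsqv ≥ 0`, `Scv + nsqv ≥ 0`): exactly file 9's displayed binders with `Λc := Λu`, `CPc := 136`, `CRc := CRu`. [folklore] -/
theorem colour_leaves_taxi_uniform (hL : 2 ≤ L) (hd : 1 ≤ d) (hM2 : ∀ μ, 1 < M μ)
    (hU : ∀ k x μ, R' k x μ ∈ unitary (ℂ →L[ℂ] ℂ)) {b : ℕ → ℝ} {c : ℝ}
    (hb : ∀ k x κ ι, ‖R' k x κ * R' k (x + unitVec (fine L (fine (L ^ k) M)) κ) ι - R' k x ι * R' k (x + unitVec (fine L (fine (L ^ k) M)) ι) κ‖ ≤ b k)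
    (hbc : ∀ k, (((L ^ (k + 1) : ℕ)) : ℝ) ^ 2 * b k ≤ c)
    (hcoh : ∀ k, coarseTv L (fine (L ^ (k + 1)) M) (R' (k + 1)) = Rtrv (L ^ k) L M (R' k))
    (hsm1 : 60 * (6 : ℝ) ^ (d - 1) * ((2 * ((((d - 1 : ℕ) : ℝ) + (d : ℝ) * d)) + 3 * ((d - 1 : ℕ) : ℝ)) * c) ≤ 1 / 2)
    (hsm2 : 2 * (d : ℝ) * ((((d - 1 : ℕ) : ℝ)) * c) ^ 2 ≤ 1 / 2) (hsm3 : 64 * (2 * ((((d - 1 : ℕ) : ℝ) + (d : ℝ) * d) * c)) ^ 2 ≤ 1)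
    (hsm6 : 64 * (d : ℝ) * ((((d - 1 : ℕ) : ℝ)) * c) ^ 2 ≤ 1 / 2) :
    let Λcu : ℝ := 2 * d * (36 : ℝ) ^ d * ((1 + ((d - 1 : ℕ) : ℝ) * c) ^ 2 + 9)
    let CRu : ℝ := 2 * Λcu + 2 * d * c + (d : ℝ) ^ 2 * c ^ 2 * 136
    let ε₁u : ℝ := ((d : ℝ) / 4 + 1 / 2) * L
    let δ'u : ℝ := Real.sqrt (2 * d * (1 + (d : ℝ) ^ 2)) * (2 * ((d - 1 : ℕ) : ℝ) * L * c)
    let Λu : ℝ := Λcu + (ε₁u * CRu + 2 * δ'u * Real.sqrt ((1 + ε₁u * CRu) * 136) + δ'u ^ 2 * 136) * (Λcu + 1)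
    0 ≤ Λu ∧ 0 ≤ CRu ∧
    (∀ k, ∀ ψ : Tor M → ℂ, ∃ f, Qkv (L ^ k) M (taxiTv (L ^ k) M (Rlev L M R' k)) f = ψ ∧ Scv (L ^ k) M (Rlev L M R' k) f ≤ Λu * nsqv ψ) ∧
    (∀ k, ∀ ψ : Tor M → ℂ, ∃ g, Qkv (L ^ k) M (taxiTv (L ^ k) M (Rlev L M R' k)) (Q1v (L ^ k) L M (taxiTv L (fine (L ^ k) M) (R' k)) g) = ψ ∧ Sfv (L ^ k) L M (R' k) g ≤ Λu * nsqv ψ) ∧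
    (∀ k, ∀ f, qWv (L ^ k) M f ≤ (136 : ℝ) * (Scv (L ^ k) M (Rlev L M R' k) f + nsqv (Qkv (L ^ k) M (taxiTv (L ^ k) M (Rlev L M R' k)) f))) ∧
    (∀ k, ∀ g, qVv (L ^ k) L M g ≤ (136 : ℝ) * (Sfv (L ^ k) L M (R' k) g + nsqv (Qkv (L ^ k) M (taxiTv (L ^ k) M (Rlev L M R' k)) (Q1v (L ^ k) L M (taxiTv L (fine (L ^ k) M) (R' k)) g)))) ∧
    (∀ k, ∀ (ψ : Tor M → ℂ) f, Qkv (L ^ k) M (taxiTv (L ^ k) M (Rlev L M R' k)) f = ψ → (∀ f₂, Qkv (L ^ k) M (taxiTv (L ^ k) M (Rlev L M R' k)) f₂ = ψ → Scv (L ^ k) M (Rlev L M R' k) f ≤ Scv (L ^ k) M (Rlev L M R' k) f₂) →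
      rhov (L ^ k) M (Rlev L M R' k) f ≤ CRu * (Scv (L ^ k) M (Rlev L M R' k) f + nsqv ψ)) := by
  intro Λcu CRu ε₁u δ'u Λu
  have hL1 : 1 ≤ L := le_trans (by norm_num) hL
  have hd0 : (0 : ℝ) ≤ d := Nat.cast_nonneg d
  have hL0 : (0 : ℝ) ≤ L := Nat.cast_nonneg L
  have hD0 : (0 : ℝ) ≤ ((d - 1 : ℕ) : ℝ) := Nat.cast_nonneg _
  have hN : ∀ k, (0 : ℝ) ≤ ((L ^ k : ℕ) : ℝ) := fun k => Nat.cast_nonneg _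
  have hb0 : ∀ k, 0 ≤ b k := fun k => (norm_nonneg _).trans (hb k 0 ⟨0, hd⟩ ⟨0, hd⟩)
  -- the class package: level plaquette bounds `a_k` in the same class and the two-level Poincaré smallness
  obtain ⟨a, ha0, ha, hac, -, hsmallP, -, -, -⟩ := taxiClassPackage L M hL hd hU hb hbc hsm1 hsm2 hsm3 (CG := fun _ => (d : ℝ)) (C₀ := fun _ => 0)
    (CGs := (d : ℝ)) (c₀ := 0) (fun _ => Nat.cast_nonneg d) (fun _ => le_rfl) (fun _ => le_rfl) (fun _ => by simp)
  have hc0 : 0 ≤ c := le_trans (by have := ha0 0; positivity) (hac 0)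
  -- the two further per-level smallness lines `colour_leaves_taxi` wants (leaf-04-g7's file 8 pattern)
  have hLkL : ∀ k, (((L ^ k : ℕ) : ℝ)) * L * ((L - 1 : ℕ) : ℝ) * b k ≤ c := fun k => by
    have hL1r : ((L - 1 : ℕ) : ℝ) ≤ L := by exact_mod_cast Nat.sub_le L 1
    have hN1 : (1 : ℝ) ≤ ((L ^ k : ℕ) : ℝ) := by exact_mod_cast Nat.one_le_pow k L hL1
    have hcast : (((L ^ (k + 1) : ℕ)) : ℝ) = ((L ^ k : ℕ) : ℝ) * L := by push_cast; ring
    have hc1 : (((L ^ k : ℕ) : ℝ) * L) ^ 2 * b k ≤ c := by rw [← hcast]; exact hbc k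
    calc (((L ^ k : ℕ) : ℝ)) * L * ((L - 1 : ℕ) : ℝ) * b k ≤ (((L ^ k : ℕ) : ℝ)) * L * L * b k :=
          mul_le_mul_of_nonneg_right (mul_le_mul_of_nonneg_left hL1r (by positivity)) (hb0 k)
      _ = 1 * ((((L ^ k : ℕ) : ℝ)) * L * L * b k) := (one_mul _).symm
      _ ≤ ((L ^ k : ℕ) : ℝ) * ((((L ^ k : ℕ) : ℝ)) * L * L * b k) := mul_le_mul_of_nonneg_right hN1 (by have := hb0 k; positivity)
      _ = (((L ^ k : ℕ) : ℝ) * L) ^ 2 * b k := by ring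
      _ ≤ c := hc1
  have hsmallL : ∀ k, 2 * (d : ℝ) * ((L : ℝ) * (((d - 1 : ℕ) : ℝ) * ((L - 1 : ℕ) : ℝ) * b k)) ^ 2 ≤ 1 / 2 := fun k => by
    have h0 : 0 ≤ (L : ℝ) * (((d - 1 : ℕ) : ℝ) * ((L - 1 : ℕ) : ℝ) * b k) := by have := hb0 k; positivity
    have hN1 : (1 : ℝ) ≤ ((L ^ k : ℕ) : ℝ) := by exact_mod_cast Nat.one_le_pow k L hL1
    have h3 : (L : ℝ) * (((d - 1 : ℕ) : ℝ) * ((L - 1 : ℕ) : ℝ) * b k) ≤ ((d - 1 : ℕ) : ℝ) * c := by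
      have h4 : (L : ℝ) * ((L - 1 : ℕ) : ℝ) * b k ≤ c := by
        calc (L : ℝ) * ((L - 1 : ℕ) : ℝ) * b k = 1 * ((L : ℝ) * ((L - 1 : ℕ) : ℝ) * b k) := (one_mul _).symm
          _ ≤ ((L ^ k : ℕ) : ℝ) * ((L : ℝ) * ((L - 1 : ℕ) : ℝ) * b k) := mul_le_mul_of_nonneg_right hN1 (by have := hb0 k; positivity)
          _ = (((L ^ k : ℕ) : ℝ)) * L * ((L - 1 : ℕ) : ℝ) * b k := by ring
          _ ≤ c := hLkL k
      calc (L : ℝ) * (((d - 1 : ℕ) : ℝ) * ((L - 1 : ℕ) : ℝ) * b k) = ((d - 1 : ℕ) : ℝ) * ((L : ℝ) * ((L - 1 : ℕ) : ℝ) * b k) := by ring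
        _ ≤ ((d - 1 : ℕ) : ℝ) * c := mul_le_mul_of_nonneg_left h4 hD0
    have h1 := pow_le_pow_left₀ h0 h3 2
    exact (mul_le_mul_of_nonneg_left h1 (by positivity)).trans hsm2
  have habsorb : ∀ k, 64 * (d : ℝ) * ((((L ^ k : ℕ) : ℝ)) * (((d - 1 : ℕ) : ℝ) * L * ((L - 1 : ℕ) : ℝ) * b k)) ^ 2 ≤ 1 / 2 := fun k => by
    have h0 : 0 ≤ (((L ^ k : ℕ) : ℝ)) * (((d - 1 : ℕ) : ℝ) * L * ((L - 1 : ℕ) : ℝ) * b k) := by have := hb0 k; positivity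
    have h3 : (((L ^ k : ℕ) : ℝ)) * (((d - 1 : ℕ) : ℝ) * L * ((L - 1 : ℕ) : ℝ) * b k) ≤ ((d - 1 : ℕ) : ℝ) * c := by
      calc (((L ^ k : ℕ) : ℝ)) * (((d - 1 : ℕ) : ℝ) * L * ((L - 1 : ℕ) : ℝ) * b k) = ((d - 1 : ℕ) : ℝ) * ((((L ^ k : ℕ) : ℝ)) * L * ((L - 1 : ℕ) : ℝ) * b k) := by ring
        _ ≤ ((d - 1 : ℕ) : ℝ) * c := mul_le_mul_of_nonneg_left (hLkL k) hD0
    have h4 := pow_le_pow_left₀ h0 h3 2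
    exact (mul_le_mul_of_nonneg_left h4 (by positivity)).trans hsm6
  -- the uniform majorants (§1 at every level)
  have hcl := fun k => leaf_consts_le (d := d) L hL1 (ha0 k) (hb0 k) (hac k) (hbc k)
  refine ⟨(hcl 0).2.2.2.2.2.2.2.2.2.2.2, (hcl 0).2.2.2.2.2.2.2.2.2.2.1, fun k ψ => ?_, fun k ψ => ?_, fun k f => ?_, fun k g => ?_, fun k ψ f hf hmin => ?_⟩
  · obtain ⟨-, -, hUBc, -, -, -, -⟩ := colour_leaves_taxi L M hU hb hcoh hM2 k (ha0 k) (ha k) (hb0 k) (hsmallP k) (hsmallL k) (habsorb k)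
    obtain ⟨f, hf, h⟩ := hUBc ψ
    exact ⟨f, hf, h.trans (mul_le_mul_of_nonneg_right (hcl k).2.2.2.2.2.2.2.2.2.1 (nsqv_nonneg ψ))⟩
  · obtain ⟨-, -, -, hUBf, -, -, -⟩ := colour_leaves_taxi L M hU hb hcoh hM2 k (ha0 k) (ha k) (hb0 k) (hsmallP k) (hsmallL k) (habsorb k)
    obtain ⟨g, hg, h⟩ := hUBf ψ
    exact ⟨g, hg, h.trans (mul_le_mul_of_nonneg_right (hcl k).2.2.2.2.2.2.2.2.2.1 (nsqv_nonneg ψ))⟩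
  · obtain ⟨-, -, -, -, hPc, -, -⟩ := colour_leaves_taxi L M hU hb hcoh hM2 k (ha0 k) (ha k) (hb0 k) (hsmallP k) (hsmallL k) (habsorb k)
    exact hPc f
  · obtain ⟨-, -, -, -, -, hPf, -⟩ := colour_leaves_taxi L M hU hb hcoh hM2 k (ha0 k) (ha k) (hb0 k) (hsmallP k) (hsmallL k) (habsorb k)
    exact hPf g
  · obtain ⟨-, -, -, -, -, -, hREG⟩ := colour_leaves_taxi L M hU hb hcoh hM2 k (ha0 k) (ha k) (hb0 k) (hsmallP k) (hsmallL k) (habsorb k)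
    have h := hREG ψ f hf hmin
    exact h.trans (mul_le_mul_of_nonneg_right (hcl k).2.2.2.1 (add_nonneg (Scv_nonneg (L ^ k) M _ f) (nsqv_nonneg ψ)))

/-! ## §3 The END from operator data -/

/-- **THE VECTOR END WITH RATE AT BAŁABAN's TAXI DATA FOR THE COVARIANT PROJECTED GAUGE FUNCTIONAL, FROM OPERATOR DATA** — file 9's END with the colour scalar pair's
five leaves at the taxi frames SUPPLIED by §2 (`Λc := Λu`, `CPc := 136`, `CRc := CRu`).  DISPLAYED: the one-step bond data and its classes, the regular presentation of
`Rlev k` and its classes, numeric smallness; NO analytic socket. [folklore] -/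
theorem towerLimitRate_effV_taxiTower_projG_of_data (hL : 2 ≤ L) (hd : 1 ≤ d) (hM2 : ∀ μ, 1 < M μ)
    -- the one-step bond data: unitary, plaquette class, coherent
    (hU : ∀ k x μ, R' k x μ ∈ unitary (ℂ →L[ℂ] ℂ)) {b : ℕ → ℝ} {c : ℝ}
    (hb : ∀ k x κ ι, ‖R' k x κ * R' k (x + unitVec (fine L (fine (L ^ k) M)) κ) ι - R' k x ι * R' k (x + unitVec (fine L (fine (L ^ k) M)) ι) κ‖ ≤ b k)
    (hbc : ∀ k, (((L ^ (k + 1) : ℕ)) : ℝ) ^ 2 * b k ≤ c)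
    (hcoh : ∀ k, coarseTv L (fine (L ^ (k + 1)) M) (R' (k + 1)) = Rtrv (L ^ k) L M (R' k))
    -- the polynomial smallness of the class constant (parts 6–8's four + the two-step frames' class + FED⁺'s absorption)
    (hsm1 : 60 * (6 : ℝ) ^ (d - 1) * ((2 * ((((d - 1 : ℕ) : ℝ) + (d : ℝ) * d)) + 3 * ((d - 1 : ℕ) : ℝ)) * c) ≤ 1 / 2)
    (hsm2 : 2 * (d : ℝ) * ((((d - 1 : ℕ) : ℝ)) * c) ^ 2 ≤ 1 / 2) (hsm3 : 64 * (2 * ((((d - 1 : ℕ) : ℝ) + (d : ℝ) * d) * c)) ^ 2 ≤ 1)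
    (hsm4 : 80 * ((d : ℝ) * c) ≤ 1) (hsm5 : 2 * (d : ℝ) * (3 * ((d - 1 : ℕ) : ℝ) * L * c) ^ 2 ≤ 1 / 2) (hsm6 : 64 * (d : ℝ) * ((((d - 1 : ℕ) : ℝ)) * c) ^ 2 ≤ 1 / 2)
    -- the DISPLAYED regular presentation of the tower's unit-lattice bond fields and the numeric smallness replacing (GF3)
    {ar ℓr : ℕ → ℝ} {α lam : ℝ} (har0 : ∀ k, 0 ≤ ar k) (har : ∀ k x μ, ‖Rlev L M R' k x μ - 1‖ ≤ ar k)
    (hℓr : ∀ k x μ, ‖Rlev L M R' k x μ - Rlev L M R' k (x - unitVec (fine (L ^ k) M) μ) μ‖ ≤ ℓr k)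
    (hα : ∀ k, (((L ^ k : ℕ)) : ℝ) * ar k ≤ α) (hlam : ∀ k, (((L ^ k : ℕ)) : ℝ) ^ 2 * ℓr k ≤ lam)
    (hsmallδ : (18 * (d * ((d + 1 : ℝ) * Cst d 1)) + 6) * deltaGap d 1 α lam (d * α) (((d - 1 : ℕ) : ℝ) * c) ^ 2 ≤ 1 / 2)
    (hsmallQ : ((d + 1 : ℝ) * Cst d 1) * (7 * (d * α ^ 2) + 2 * (2 * ((((d - 1 : ℕ) : ℝ) + (d : ℝ) * d) * c) + (d * α + α)) ^ 2) ≤ 1 / 2)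
    -- the effective-operator parameter and the rate (`0 < θ < 1`, `θ² ≥ L⁻¹`: the half exponent of the harmonic-approximation defect inside (G″))
    {aa : ℝ} (haa : 0 < aa) {θ : ℝ} (hθ0 : 0 < θ) (hθL : (L : ℝ)⁻¹ ≤ θ ^ 2) (hθ1 : θ < 1)
    -- file 6's `hcF` line and the two (ONE-min) transfer smallness lines (`v ≤ ⅛`, `γ ≤ ¼` under the class; polynomial in `c`)
    (hsm7 : 60 * (6 : ℝ) ^ (d - 1) * ((2 * ((((d - 1 : ℕ) : ℝ)) + (d : ℝ) * d) + 5 * ((d - 1 : ℕ) : ℝ)) * c) ≤ 1 / 2)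
    (hsmV : (2 * ((4 * ((d : ℝ) * ((d : ℝ) * c)) * (4 * d * (36 : ℝ) ^ d * (1 + 3 * ((d - 1 : ℕ) : ℝ) * L * c) ^ 2)) ^ 2 * ((d : ℝ) * ((2 * (1 + (36 * (d * ((d + 1 : ℝ) * Cst d 1)) + 8))) + (2 * ((24 * (d * ((d + 1 : ℝ) * Cst d 1)) + 4) + d * c * 64)))))) ≤ 1 / 8)
    (hsmG : ((3 * (((d - 1 : ℕ) : ℝ) * c)) ^ 2 * (max (40 * (2 * (1 + (36 * (d * ((d + 1 : ℝ) * Cst d 1)) + 8)))) (64 + 40 * (2 * ((24 * (d * ((d + 1 : ℝ) * Cst d 1)) + 4) + d * c * 64))))) ≤ 1 / 4) :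
    -- the colour scalar pair's UNIFORM constants at the taxi frames (majorants of `colour_leaves_taxi`'s level constants under the class; `C_P = 136`)
    let Λcu : ℝ := 2 * d * (36 : ℝ) ^ d * ((1 + ((d - 1 : ℕ) : ℝ) * c) ^ 2 + 9)
    let CRu : ℝ := 2 * Λcu + 2 * d * c + (d : ℝ) ^ 2 * c ^ 2 * 136
    let ε₁u : ℝ := ((d : ℝ) / 4 + 1 / 2) * L
    let δ'u : ℝ := Real.sqrt (2 * d * (1 + (d : ℝ) ^ 2)) * (2 * ((d - 1 : ℕ) : ℝ) * L * c)
    let Λu : ℝ := Λcu + (ε₁u * CRu + 2 * δ'u * Real.sqrt ((1 + ε₁u * CRu) * 136) + δ'u ^ 2 * 136) * (Λcu + 1)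
    -- the constants: part 8's G-side constants, file 3's V-REG′ sum, file 2b's (G″) decay constant
    let CDs : ℝ := 36 * (d * ((d + 1 : ℝ) * Cst d 1)) + 8
    let CDs' : ℝ := 24 * (d * ((d + 1 : ℝ) * Cst d 1)) + 4
    let Λs : ℝ := 4 * lamV d (((d - 1 : ℕ) : ℝ) * c) (d : ℝ) 0
    let κs : ℝ := 2 * (1 + CDs)
    let κs' : ℝ := 2 * (CDs' + (d : ℝ) * c * 64)
    let CPs : ℝ := max (40 * κs) (64 + 40 * κs')
    let RPs : ℝ := 4 * d * (36 : ℝ) ^ d * (1 + ((d - 1 : ℕ) : ℝ) * c) ^ 2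
    let CRvs : ℝ := 8 * Λs + 2 * d * c * (κs + κs') + (8 * RPs ^ 2 + 5 * (d : ℝ) ^ 2 * c ^ 2) * CPs
    let CRs' : ℝ := CRvs + κs + κs' + CPs + CDs + CDs'
    let Λcs : ℝ := 2 * d * (36 : ℝ) ^ d * ((4 + ((d - 1 : ℕ) : ℝ) * c) ^ 2 + 9)
    let CRHs : ℝ := 2 * Λcs + 2 * d * c + (d : ℝ) ^ 2 * c ^ 2 * 136
    let ε₁s : ℝ := ((d : ℝ) / 4 + 1 / 2) * L
    let δ's : ℝ := Real.sqrt (2 * d * (1 + (d : ℝ) ^ 2)) * (2 * ((d - 1 : ℕ) : ℝ) * L * c)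
    let ΛHs : ℝ := Λcs + (ε₁s * CRHs + 2 * δ's * Real.sqrt ((1 + ε₁s * CRHs) * 136) + δ's ^ 2 * 136) * (Λcs + 1)
    let EHs : ℝ := ePV ΛHs 136 CRHs ε₁s δ's + eV ΛHs 136 (Real.sqrt d * (((d - 1 : ℕ) : ℝ) * c))
    let Cε : ℝ := Real.sqrt (3 * d) * (2 + 2 * (((d - 1 : ℕ) : ℝ) * c)) + Real.sqrt (136 * EHs) + 4 * (d : ℝ) ^ 2 * c * RPs
    -- the (ONE-min) decay constants of files 7 ∕ 8 at the (GF3) constants, the colour pair's and part 8's `CRvs`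
    let EH1 : ℝ := ((((d : ℝ) / 4 + 1 / 2) * L) * CRu * (Λu + 1)
          + 2 * (Real.sqrt (2 * d * (1 + (d : ℝ) ^ 2)) * (L * (2 * ((d - 1 : ℕ) : ℝ) * c))) * Real.sqrt ((Λu + (((d : ℝ) / 4 + 1 / 2) * L) * CRu * (Λu + 1)) * ((136 : ℝ) * (Λu + 1)))
          + (Real.sqrt (2 * d * (1 + (d : ℝ) ^ 2)) * (L * (2 * ((d - 1 : ℕ) : ℝ) * c))) ^ 2 * ((136 : ℝ) * (Λu + 1))
          + 2 * (Real.sqrt d * (((d - 1 : ℕ) : ℝ) * c)) * Real.sqrt (Λu * ((136 : ℝ) * (Λu + 1))))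
    let E21 : ℝ := (1 + 6 * ((8 * d * (CRvs + (1 + (2 * ((d - 1 : ℕ) : ℝ) * c)) ^ 2 * ((d : ℝ) / 4 * L * CRvs) + (2 * ((d - 1 : ℕ) : ℝ) * c) ^ 2 * ((2 * (1 + CDs)) + (2 * (CDs' + d * c * 64))) + 2 * (1 + (d : ℝ) ^ 2) * (L : ℝ) ^ 2 * ((2 * ((d - 1 : ℕ) : ℝ) * c) ^ 2 * (max (40 * (2 * (1 + CDs))) (64 + 40 * (2 * (CDs' + d * c * 64))))))) + ((d : ℝ) / 2 * (2 * d * CRvs + 2 * (d : ℝ) ^ 2 * (c ^ 2 * (max (40 * (2 * (1 + CDs))) (64 + 40 * (2 * (CDs' + d * c * 64))))))) + ((d : ℝ) / 4 * (2 * (2 * d * CRvs + 2 * (d : ℝ) ^ 2 * (c ^ 2 * (max (40 * (2 * (1 + CDs))) (64 + 40 * (2 * (CDs' + d * c * 64)))))) + 2 * (Λu * (CDs + CDs')))) + ((136 : ℝ) * EH1 * (CDs + CDs'))))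
    let EPS1 : ℝ := (1 + 2 * ((1 + 2 * (d * (L : ℝ))) * (1 + CRvs) + E21) + 2 * ((4 * lamV d (((d - 1 : ℕ) : ℝ) * (3 * L * c)) (d : ℝ) 0) * (25 / 4 * ((2 * (1 + CDs)) + (2 * (CDs' + d * c * 64))))))
    let V1 : ℝ := (2 * ((4 * ((d : ℝ) * ((d : ℝ) * c)) * (4 * d * (36 : ℝ) ^ d * (1 + 3 * ((d - 1 : ℕ) : ℝ) * L * c) ^ 2)) ^ 2 * ((d : ℝ) * ((2 * (1 + CDs)) + (2 * (CDs' + d * c * 64))))))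
    let G1 : ℝ := ((3 * (((d - 1 : ℕ) : ℝ) * c)) ^ 2 * (max (40 * (2 * (1 + CDs))) (64 + 40 * (2 * (CDs' + d * c * 64)))))
    let DPR1 : ℝ := (Real.sqrt (8 * d * (1 + (d : ℝ) ^ 2)) * (L * (2 * ((d - 1 : ℕ) : ℝ) * c)))
    let p1 : ℝ := (1 + 2 * ((4 * lamV d (((d - 1 : ℕ) : ℝ) * c) (d : ℝ) 0) * G1) * (1 + 4 * G1))
    let As1 : ℝ := (1 + p1) * (1 + 4 * V1) * 2
    let Cε1 : ℝ := (1 + 2 * p1 + 8 * V1 + 8 * p1 * V1) + As1 * EPS1 + (4 * V1 * ((1 + p1) * (1 + 4 * V1)) + 8 * ((4 * lamV d (((d - 1 : ℕ) : ℝ) * c) (d : ℝ) 0) * G1))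
    let Cδ1 : ℝ := Real.sqrt As1 * DPR1
    TowerLimitRate (ι := fun _ => Tor M × Fin d) (fun _ => (1 : Matrix (Tor M × Fin d) (Tor M × Fin d) ℂ)) 1
      (fun k => effV (L ^ k) M (Rlev L M R' k)
        (GmProj (fine (L ^ k) M) (Rlev L M R' k) (LinearMap.ker (avgOp (L ^ k) M (taxiTv (L ^ k) M (Rlev L M R' k))))) (QmL (L ^ k) M (nestLv L M R' k)) aa)
      (eV Λs (CPs + CRs') (2 * d * ((d : ℝ) * c + L * c) + Cε) + ePV Λs CPs 1 Cε1 Cδ1) θ := by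
  intro Λcu CRu ε₁u δ'u Λu CDs CDs' Λs κs κs' CPs RPs CRvs CRs' Λcs CRHs ε₁s δ's ΛHs EHs Cε EH1 E21 EPS1 V1 G1 DPR1 p1 As1 Cε1 Cδ1
  obtain ⟨hΛu0, hCRu0, hUBc, hUBf, hPcc, hPf, hREGc⟩ := colour_leaves_taxi_uniform L M hL hd hM2 hU hb hbc hcoh hsm1 hsm2 hsm3 hsm6
  exact towerLimitRate_effV_taxiTower_projG_of_class L M hL hd hM2 hU hb hbc hcoh hsm1 hsm2 hsm3 hsm4 hsm5 hsm6 har0 har hℓr hα hlam hsmallδ hsmallQ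
    haa hθ0 hθL hθ1 hsm7 hsmV hsmG hΛu0 (by norm_num) hCRu0 hUBc hUBf hPcc hPf hREGc

end Taxi

end Summit.QuantumFields.BalabanUV.T4Continuum.VariationalColourTaxiTowerProjGRateData

end
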